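import Mathlib
import HarnessLib
import Literature.MathematicalPhysics.StatisticalMechanics.RelevantHamiltonians
import Literature.MathematicalPhysics.StatisticalMechanics.TaylorPolynomialNorms
import Literature.MathematicalPhysics.StatisticalMechanics.TaylorPolynomialNormsPullback
import Literature.MathematicalPhysics.StatisticalMechanics.GradientFieldNorms

/-!
# The norm `‖H‖_{k,0}` of a relevant Hamiltonian and the bound `|H(B)|_{k,B,T_φ} ≤ (1+|φ|)² ‖H‖_{k,0}`
# (Adams–Buchholz–Kotecký–Müller (6.51), Lemma 8.9 direction "≤")

For a relevant Hamiltonian `H ∈ M_0(𝓑_k)` (`RelevantHamiltonians.lean`: coefficients `λ`, `a_α`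
(`1 ≤ |α| ≤ ⌊d/2⌋+1`), `a_{ij}` of the monomials `1`, `∇^αφ(x)`, `∇_iφ(x)∇_jφ(x)` summed over a
block `B`) [ABKM19] (6.51) introduces the coefficient norm

`‖H‖_{k,0} = L^{dk}|λ| + Σ_α h_k L^{dk} L^{-k(d-2)/2} L^{-k|α|} |a_α| + Σ_{(i,α)≤(j,β)} h_k² |a_{(i,α),(j,β)}|`

"chosen in such a way that `‖·‖_{k,0}` is equivalent (uniformly in `k` and `N`) to the strong norm"
(loc. cit.; [ABKM19] Lemma 8.9 `le:Htp_vs_Hk0`).  In the parameters of the field gauge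
`fieldGauge 𝔥 R p S` (`𝔥 = h_k L^{-k(d-2)/2}`, `R = L^k`) and with `n_B = |B| = L^{dk}` sites, the
three weights are `n_B`, `n_B · 𝔥 R^{-|α|}` and `n_B (𝔥/R)² = h_k²` — `hamNorm 𝔥 R n_B H` below.

This file proves the "≤" half of the equivalence, pointwise in the field:

* **`tayNorm_eval_le`** — for `B ⊆ S`, `p ≥ ⌊d/2⌋+1`:
  `|H(B)|_{T_φ} ≤ (1 + ‖T φ‖)² · hamNorm 𝔥 R |B| H`
  (Taylor norm relative to `fieldGauge 𝔥 R p S`; at `φ = 0` this is `|H(B)|_{k,B,T_0} ≤ ‖H‖_{k,0}`);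

from the generic pieces `tayNorm_sum_le`, `tayNorm_mul_const_le` and **`tayNorm_clm_comp_le`**
(`‖g ∘ P‖_{T_φ} ≤ ‖g(Pφ)‖ + c‖g‖` for a continuous LINEAR `g` and `‖Pξ‖ ≤ c‖Tξ‖`: a linear
functional has only two Taylor coefficients), applied to the monomials.

Everything is proved; no named fact.  What is NOT here: the converse bound (the "≥" half of
Lemma 8.9, via the projection `Π_2`), and the strong weight `W_k^B` (which turns `(1+‖Tφ‖)²` into a
constant).

## References
* S. Adams, S. Buchholz, R. Kotecký, S. Müller, arXiv:1910.13564, Ch. 6.4 (6.51), Lemma 8.9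
  [AdamsBuchholzKoteckyMuller2019].
-/

noncomputable section

namespace Literature.MathematicalPhysics.StatisticalMechanics.GradientRG

open Finset
open Literature.MathematicalPhysics.StatisticalMechanics.GradientFRD (fwdDiff iterDiff)

section Generic

variable {E V : Type*} [NormedAddCommGroup E] [NormedSpace ℝ E] [FiniteDimensional ℝ E]
  [NormedAddCommGroup V] [NormedSpace ℝ V]
  {𝔸 : Type*} [NormedRing 𝔸] [NormedAlgebra ℝ 𝔸]

/-- **Finite sums**: `‖Σ_i F_i‖_{T_φ} ≤ Σ_i ‖F_i‖_{T_φ}` for `C^{r₀}` functionals.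
[cite: AdamsBuchholzKoteckyMuller2019, Definition 13.7] -/
theorem tayNorm_sum_le (T : E →ₗ[ℝ] V) {r₀ : ℕ} {ι : Type*} (s : Finset ι) {F : ι → E → 𝔸}
    (hF : ∀ i ∈ s, ContDiff ℝ r₀ (F i)) (φ : E) :
    tayNorm T r₀ (fun ψ => ∑ i ∈ s, F i ψ) φ ≤ ∑ i ∈ s, tayNorm T r₀ (F i) φ := by
  classical
  induction s using Finset.induction_on with
  | empty =>
    simp only [Finset.sum_empty]
    rw [tayNorm_const, norm_zero]
  | insert a s ha ih =>
    have hFa : ContDiff ℝ r₀ (F a) := hF a (Finset.mem_insert_self a s)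
    have hrest : ∀ j ∈ s, ContDiff ℝ r₀ (F j) := fun j hj => hF j (Finset.mem_insert_of_mem hj)
    have hsum : ContDiff ℝ r₀ (fun ψ => ∑ i ∈ s, F i ψ) := ContDiff.sum hrest
    have heq : (fun ψ => ∑ i ∈ insert a s, F i ψ) = F a + fun ψ => ∑ i ∈ s, F i ψ := by
      funext ψ; rw [Finset.sum_insert ha]; rfl
    rw [heq, Finset.sum_insert ha]
    exact (tayNorm_add_le T hFa hsum φ).trans (add_le_add le_rfl (ih hrest))

/-- `‖F · a‖_{T_φ} ≤ ‖F‖_{T_φ} ‖a‖` for a constant `a`. [cite: AdamsBuchholzKoteckyMuller2019, Proposition 13.9] -/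
theorem tayNorm_mul_const_le (T : E →ₗ[ℝ] V) {r₀ : ℕ} {F : E → 𝔸} (hF : ContDiff ℝ r₀ F) (a : 𝔸)
    (φ : E) : tayNorm T r₀ (fun ψ => F ψ * a) φ ≤ tayNorm T r₀ F φ * ‖a‖ := by
  have h := tayNorm_mul_le T hF (contDiff_const (c := a)) φ
  rw [tayNorm_const] at h
  exact h

/-- **A linear functional has two Taylor coefficients**: for a continuous linear `g : U →L 𝔸` and
a linear `P : E →ₗ U` with `‖P ξ‖ ≤ c‖T ξ‖` (`c ≥ 0`),
`‖g ∘ P‖_{T_φ} ≤ ‖g(Pφ)‖ + c ‖g‖` (with equality for `r₀ ≥ 1` up to the estimate `‖Q‖ ≤ c`).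
[cite: AdamsBuchholzKoteckyMuller2019, App. A.5 (13.29) (norm of the linear monomials)] -/
theorem tayNorm_clm_comp_le {U : Type*} [NormedAddCommGroup U] [NormedSpace ℝ U] (T : E →ₗ[ℝ] V)
    (P : E →ₗ[ℝ] U) {c : ℝ} (hc : 0 ≤ c) (hP : ∀ ξ, ‖P ξ‖ ≤ c * ‖T ξ‖) (g : U →L[ℝ] 𝔸) (r₀ : ℕ)
    (φ : E) : tayNorm T r₀ (fun ψ => g (P ψ)) φ ≤ ‖g (P φ)‖ + c * ‖g‖ := by
  have h := tayNorm_le_of_factor T P hc hP (g.contDiff (n := r₀)) (F := fun ψ => g (P ψ))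
    (fun _ => rfl) φ
  refine h.trans ?_
  -- the Taylor coefficients of `g`: order 0 is `g u`, order 1 has norm `‖g‖`, higher orders vanish
  have hfd : fderiv ℝ (⇑g) = fun _ => g := by funext u; exact g.fderiv
  have h0 : ‖iteratedFDeriv ℝ 0 (⇑g) (P φ)‖ = ‖g (P φ)‖ := norm_iteratedFDeriv_zero
  have h1 : ‖iteratedFDeriv ℝ 1 (⇑g) (P φ)‖ = ‖g‖ := by
    rw [← norm_iteratedFDeriv_fderiv, norm_iteratedFDeriv_zero, hfd]
  have h2 : ∀ s, ‖iteratedFDeriv ℝ (s + 2) (⇑g) (P φ)‖ = 0 := by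
    intro s
    rw [← norm_iteratedFDeriv_fderiv, hfd, iteratedFDeriv_succ_const, Pi.zero_apply, norm_zero]
  rcases Nat.eq_zero_or_pos r₀ with hr | hr
  · subst hr
    simp only [zero_add, Finset.range_one, Finset.sum_singleton, Nat.factorial_zero, Nat.cast_one,
      inv_one, one_mul, pow_zero, mul_one, h0]
    exact le_add_of_nonneg_right (mul_nonneg hc (norm_nonneg _))
  · obtain ⟨r, rfl⟩ : ∃ r, r₀ = r + 1 := ⟨r₀ - 1, by omega⟩
    rw [Finset.sum_range_succ', Finset.sum_range_succ']
    rw [Finset.sum_eq_zero fun s _ => by rw [h2, zero_mul, mul_zero]]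
    simp only [zero_add, Nat.factorial, Nat.cast_one, inv_one, one_mul, pow_zero, mul_one,
      pow_one, h0, h1, Nat.succ_eq_add_one, Nat.reduceAdd]
    rw [add_comm]
    exact le_of_eq (by ring)

end Generic

/-! ## The coefficient norm `‖H‖_{k,0}` and the bound on `|H(B)|_{T_φ}` -/

section Hamiltonian

variable {𝕜 : Type*} [NormedField 𝕜] [NormedAlgebra ℝ 𝕜] [NormOneClass 𝕜] {d M : ℕ}

/-- **The coefficient norm `‖H‖_{k,0}`** ([ABKM19] (6.51)) in the parameters of the field gauge:
`n_B (|λ| + Σ_α 𝔥 R^{-|α|} |a_α| + Σ_{i≤j} (𝔥/R)² |a_{ij}|)`; with `n_B = L^{dk}`,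
`𝔥 = h_k L^{-k(d-2)/2}`, `R = L^k` the weights are `L^{dk}`, `h_k L^{dk} L^{-k(d-2)/2} L^{-k|α|}`, `h_k²`,
exactly (6.51). [cite: AdamsBuchholzKoteckyMuller2019, Ch. 6.4 (6.51)] -/
def hamNorm (𝔥 R : ℝ) (nB : ℕ) (H : RelevantHamiltonian 𝕜 d) : ℝ :=
  (nB : ℝ) * (‖H (Sum.inl ())‖ +
    ∑ α : linIndex d, 𝔥 * (R ^ (∑ i, (α : Fin d → ℕ) i))⁻¹ * ‖H (Sum.inr (Sum.inl α))‖ +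
    ∑ q : quadIndex d, (𝔥 / R) ^ 2 * ‖H (Sum.inr (Sum.inr q))‖)

omit [NormedAlgebra ℝ 𝕜] [NormOneClass 𝕜] in
/-- The coefficient norm is non-negative (`𝔥, R ≥ 0`). [cite: AdamsBuchholzKoteckyMuller2019, Ch. 6.4 (6.51)] -/
theorem hamNorm_nonneg {𝔥 R : ℝ} (h𝔥 : 0 ≤ 𝔥) (hR : 0 ≤ R) (nB : ℕ) (H : RelevantHamiltonian 𝕜 d) :
    0 ≤ hamNorm 𝔥 R nB H := by
  unfold hamNorm
  refine mul_nonneg (Nat.cast_nonneg _) (add_nonneg (add_nonneg (norm_nonneg _) ?_) ?_)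
  · exact Finset.sum_nonneg fun α _ => by positivity
  · exact Finset.sum_nonneg fun q _ => by positivity

/-- Linear monomials of `M_0` are controlled by the gauge: for `α ∈ linIndex d` (`1 ≤ |α| ≤ ⌊d/2⌋+1`),
`p ≥ ⌊d/2⌋+1` and `x ∈ S`, `|∇^α ξ(x)| ≤ 𝔥 R^{-|α|} ‖T ξ‖`.
[cite: AdamsBuchholzKoteckyMuller2019, Ch. 6.4 (6.40)] -/
theorem abs_iterDiff_linIndex_le {𝔥 R : ℝ} (h𝔥 : 0 < 𝔥) (hR : 0 < R) {p : ℕ} (hp : d / 2 + 1 ≤ p)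
    {S : Finset (Fin d → ZMod M)} {x : Fin d → ZMod M} (hx : x ∈ S) (α : linIndex d)
    (ξ : (Fin d → ZMod M) → ℝ) :
    |iterDiff (α : Fin d → ℕ) ξ x| ≤
      𝔥 * (R ^ (∑ i, (α : Fin d → ℕ) i))⁻¹ * ‖fieldGauge 𝔥 R p S ξ‖ := by
  have hα : (α : Fin d → ℕ) ∈ diffIndex d p := by
    obtain ⟨h1, h2⟩ := mem_linIndex.1 α.2
    exact mem_diffIndex.2 ⟨h1, h2.trans hp⟩
  exact abs_iterDiff_le_gauge h𝔥 hR p hx hα ξ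

variable [NeZero M]

/-- The linear monomial `φ ↦ ∇^αφ(x) ∈ 𝕜` has Taylor norm `≤ 𝔥R^{-|α|}(‖Tφ‖ + 1)`.
[cite: AdamsBuchholzKoteckyMuller2019, App. A.5 (13.29)] -/
theorem tayNorm_linMonomial_le {𝔥 R : ℝ} (h𝔥 : 0 < 𝔥) (hR : 0 < R) {p : ℕ} (hp : d / 2 + 1 ≤ p)
    {S : Finset (Fin d → ZMod M)} {x : Fin d → ZMod M} (hx : x ∈ S) (α : linIndex d) (r₀ : ℕ)
    (φ : (Fin d → ZMod M) → ℝ) :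
    tayNorm (fieldGauge 𝔥 R p S) r₀
        (fun ψ : (Fin d → ZMod M) → ℝ => (algebraMap ℝ 𝕜) (iterDiff (α : Fin d → ℕ) ψ x)) φ ≤
      𝔥 * (R ^ (∑ i, (α : Fin d → ℕ) i))⁻¹ * (‖fieldGauge 𝔥 R p S φ‖ + 1) := by
  set c : ℝ := 𝔥 * (R ^ (∑ i, (α : Fin d → ℕ) i))⁻¹ with hc_def
  have hc : 0 ≤ c := by positivity
  -- the functional `ξ ↦ ∇^α ξ(x)` as a linear map, bounded by `c ‖T ξ‖`
  let P : ((Fin d → ZMod M) → ℝ) →ₗ[ℝ] ℝ := (LinearMap.proj x).comp (iterDiffₗ (α : Fin d → ℕ))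
  have hPapply : ∀ ξ, P ξ = iterDiff (α : Fin d → ℕ) ξ x := fun ξ => rfl
  have hP : ∀ ξ, ‖P ξ‖ ≤ c * ‖fieldGauge 𝔥 R p S ξ‖ := fun ξ => by
    rw [hPapply, Real.norm_eq_abs]; exact abs_iterDiff_linIndex_le h𝔥 hR hp hx α ξ
  have h := tayNorm_clm_comp_le (fieldGauge 𝔥 R p S) P hc hP (algebraMapCLM ℝ 𝕜) r₀ φ
  have hg : ‖(algebraMapCLM ℝ 𝕜 : ℝ →L[ℝ] 𝕜)‖ ≤ 1 := by
    refine ContinuousLinearMap.opNorm_le_bound _ zero_le_one fun t => ?_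
    rw [one_mul]
    exact le_of_eq (norm_algebraMap' 𝕜 t)
  have hg0 : ‖(algebraMapCLM ℝ 𝕜 : ℝ →L[ℝ] 𝕜) (P φ)‖ = |iterDiff (α : Fin d → ℕ) φ x| := by
    rw [hPapply]
    exact (norm_algebraMap' 𝕜 _).trans (Real.norm_eq_abs _)
  calc tayNorm (fieldGauge 𝔥 R p S) r₀
        (fun ψ : (Fin d → ZMod M) → ℝ => (algebraMap ℝ 𝕜) (iterDiff (α : Fin d → ℕ) ψ x)) φ
      = tayNorm (fieldGauge 𝔥 R p S) r₀ (fun ψ => (algebraMapCLM ℝ 𝕜 : ℝ →L[ℝ] 𝕜) (P ψ)) φ := rfl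
    _ ≤ ‖(algebraMapCLM ℝ 𝕜 : ℝ →L[ℝ] 𝕜) (P φ)‖ + c * ‖(algebraMapCLM ℝ 𝕜 : ℝ →L[ℝ] 𝕜)‖ := h
    _ ≤ c * ‖fieldGauge 𝔥 R p S φ‖ + c * 1 := by
        rw [hg0]
        exact add_le_add (abs_iterDiff_linIndex_le h𝔥 hR hp hx α φ)
          (mul_le_mul_of_nonneg_left hg hc)
    _ = c * (‖fieldGauge 𝔥 R p S φ‖ + 1) := by ring

/-- The gradient monomial `φ ↦ ∇_iφ(x) ∈ 𝕜` has Taylor norm `≤ (𝔥/R)(‖Tφ‖ + 1)` (`p ≥ 1`, `x ∈ S`).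
[cite: AdamsBuchholzKoteckyMuller2019, App. A.5 (13.29)] -/
theorem tayNorm_gradMonomial_le {𝔥 R : ℝ} (h𝔥 : 0 < 𝔥) (hR : 0 < R) {p : ℕ} (hp : 1 ≤ p)
    {S : Finset (Fin d → ZMod M)} {x : Fin d → ZMod M} (hx : x ∈ S) (i : Fin d) (r₀ : ℕ)
    (φ : (Fin d → ZMod M) → ℝ) :
    tayNorm (fieldGauge 𝔥 R p S) r₀
        (fun ψ : (Fin d → ZMod M) → ℝ => (algebraMap ℝ 𝕜) (fwdDiff i ψ x)) φ ≤
      𝔥 / R * (‖fieldGauge 𝔥 R p S φ‖ + 1) := by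
  have hc : 0 ≤ 𝔥 / R := div_nonneg h𝔥.le hR.le
  let P : ((Fin d → ZMod M) → ℝ) →ₗ[ℝ] ℝ := (LinearMap.proj i).comp (gradAt x)
  have hPapply : ∀ ξ, P ξ = fwdDiff i ξ x := fun ξ => rfl
  have hPle : ∀ ξ, |fwdDiff i ξ x| ≤ 𝔥 / R * ‖fieldGauge 𝔥 R p S ξ‖ := fun ξ => by
    have h1 := norm_le_pi_norm (gradAt x ξ) i
    rw [gradAt_apply, Real.norm_eq_abs] at h1
    exact h1.trans (norm_gradAt_le_gauge h𝔥 hR hp hx ξ)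
  have hP : ∀ ξ, ‖P ξ‖ ≤ 𝔥 / R * ‖fieldGauge 𝔥 R p S ξ‖ := fun ξ => by
    rw [hPapply, Real.norm_eq_abs]; exact hPle ξ
  have h := tayNorm_clm_comp_le (fieldGauge 𝔥 R p S) P hc hP (algebraMapCLM ℝ 𝕜) r₀ φ
  have hg : ‖(algebraMapCLM ℝ 𝕜 : ℝ →L[ℝ] 𝕜)‖ ≤ 1 := by
    refine ContinuousLinearMap.opNorm_le_bound _ zero_le_one fun t => ?_
    rw [one_mul]
    exact le_of_eq (norm_algebraMap' 𝕜 t)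
  have hg0 : ‖(algebraMapCLM ℝ 𝕜 : ℝ →L[ℝ] 𝕜) (P φ)‖ = |fwdDiff i φ x| := by
    rw [hPapply]
    exact (norm_algebraMap' 𝕜 _).trans (Real.norm_eq_abs _)
  calc tayNorm (fieldGauge 𝔥 R p S) r₀
        (fun ψ : (Fin d → ZMod M) → ℝ => (algebraMap ℝ 𝕜) (fwdDiff i ψ x)) φ
      = tayNorm (fieldGauge 𝔥 R p S) r₀ (fun ψ => (algebraMapCLM ℝ 𝕜 : ℝ →L[ℝ] 𝕜) (P ψ)) φ := rfl
    _ ≤ ‖(algebraMapCLM ℝ 𝕜 : ℝ →L[ℝ] 𝕜) (P φ)‖ + 𝔥 / R * ‖(algebraMapCLM ℝ 𝕜 : ℝ →L[ℝ] 𝕜)‖ := h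
    _ ≤ 𝔥 / R * ‖fieldGauge 𝔥 R p S φ‖ + 𝔥 / R * 1 := by
        rw [hg0]
        exact add_le_add (hPle φ) (mul_le_mul_of_nonneg_left hg hc)
    _ = 𝔥 / R * (‖fieldGauge 𝔥 R p S φ‖ + 1) := by ring

/-- **`|H(B)|_{T_φ} ≤ (1 + ‖Tφ‖)² ‖H‖_{k,0}`** ([ABKM19] Lemma 8.9, the "≤" half of the equivalence of
`‖·‖_{k,0}` with the strong norm; at `φ = 0`: `|H(B)|_{k,B,T_0} ≤ ‖H‖_{k,0}`): for a relevant
Hamiltonian `H`, a set of sites `B ⊆ S` and the field gauge `T = fieldGauge 𝔥 R p S` with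
`p ≥ ⌊d/2⌋+1`. [cite: AdamsBuchholzKoteckyMuller2019, Lemma 8.9] -/
theorem tayNorm_eval_le {𝔥 R : ℝ} (h𝔥 : 0 < 𝔥) (hR : 0 < R) {p : ℕ} (hp : d / 2 + 1 ≤ p)
    {S B : Finset (Fin d → ZMod M)} (hBS : B ⊆ S) (H : RelevantHamiltonian 𝕜 d) (r₀ : ℕ)
    (φ : (Fin d → ZMod M) → ℝ) :
    tayNorm (fieldGauge 𝔥 R p S) r₀ (fun ψ : (Fin d → ZMod M) → ℝ => eval H B ψ) φ ≤
      (1 + ‖fieldGauge 𝔥 R p S φ‖) ^ 2 * hamNorm 𝔥 R B.card H := by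
  have hp1 : 1 ≤ p := le_trans (Nat.le_add_left 1 _) hp
  set T := fieldGauge 𝔥 R p S with hT
  set t : ℝ := ‖T φ‖ with ht
  have ht0 : 0 ≤ t := norm_nonneg _
  have h1t : 1 ≤ 1 + t := le_add_of_nonneg_right ht0
  -- smoothness of the monomials (as `𝕜`-valued functionals)
  have hlinCD : ∀ (α : Fin d → ℕ) (x : Fin d → ZMod M), ContDiff ℝ r₀
      (fun ψ : (Fin d → ZMod M) → ℝ => (algebraMap ℝ 𝕜) (iterDiff α ψ x)) := by
    intro α x
    have : (fun ψ : (Fin d → ZMod M) → ℝ => (algebraMap ℝ 𝕜) (iterDiff α ψ x)) =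
        fun ψ => (algebraMapCLM ℝ 𝕜 : ℝ →L[ℝ] 𝕜)
          (LinearMap.toContinuousLinearMap ((LinearMap.proj x).comp (iterDiffₗ (M := M) α)) ψ) := rfl
    rw [this]
    exact (algebraMapCLM ℝ 𝕜).contDiff.comp (ContinuousLinearMap.contDiff _)
  have hgradCD : ∀ (i : Fin d) (x : Fin d → ZMod M), ContDiff ℝ r₀
      (fun ψ : (Fin d → ZMod M) → ℝ => (algebraMap ℝ 𝕜) (fwdDiff i ψ x)) := by
    intro i x
    have : (fun ψ : (Fin d → ZMod M) → ℝ => (algebraMap ℝ 𝕜) (fwdDiff i ψ x)) =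
        fun ψ => (algebraMapCLM ℝ 𝕜 : ℝ →L[ℝ] 𝕜)
          (LinearMap.toContinuousLinearMap ((LinearMap.proj i).comp (gradAt (M := M) x)) ψ) := rfl
    rw [this]
    exact (algebraMapCLM ℝ 𝕜).contDiff.comp (ContinuousLinearMap.contDiff _)
  -- the density at one site: `𝓗({x}, ψ) = Σ_ι (monomial ι) • H ι`
  have hsite : ∀ x ∈ B, tayNorm T r₀ (fun ψ : (Fin d → ZMod M) → ℝ => density H ψ x) φ ≤
      (1 + t) ^ 2 * (‖H (Sum.inl ())‖ +
        ∑ α : linIndex d, 𝔥 * (R ^ (∑ i, (α : Fin d → ℕ) i))⁻¹ * ‖H (Sum.inr (Sum.inl α))‖ +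
        ∑ q : quadIndex d, (𝔥 / R) ^ 2 * ‖H (Sum.inr (Sum.inr q))‖) := by
    intro x hx
    have hxS : x ∈ S := hBS hx
    -- write each summand as `(algebraMap ℝ 𝕜 (monomial)) * H ι`
    have hterm : ∀ ι : RelIndex d, (fun ψ : (Fin d → ZMod M) → ℝ => relMonomial ι ψ x • H ι) =
        fun ψ => (algebraMap ℝ 𝕜) (relMonomial ι ψ x) * H ι := by
      intro ι; funext ψ; exact Algebra.smul_def _ _
    have hmonoCD : ∀ ι : RelIndex d, ContDiff ℝ r₀
        (fun ψ : (Fin d → ZMod M) → ℝ => (algebraMap ℝ 𝕜) (relMonomial ι ψ x)) := by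
      rintro (u | α | q)
      · simp only [relMonomial_const, map_one]; exact contDiff_const
      · simp only [relMonomial_lin]; exact hlinCD _ x
      · simp only [relMonomial_quad, map_mul]; exact (hgradCD _ x).mul (hgradCD _ x)
    have htermCD : ∀ ι : RelIndex d, ContDiff ℝ r₀
        (fun ψ : (Fin d → ZMod M) → ℝ => relMonomial ι ψ x • H ι) := by
      intro ι; rw [hterm]; exact (hmonoCD ι).mul contDiff_const
    -- bound each monomial
    have hmono : ∀ ι : RelIndex d,
        tayNorm T r₀ (fun ψ : (Fin d → ZMod M) → ℝ => relMonomial ι ψ x • H ι) φ ≤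
        (match ι with
          | Sum.inl _ => (1 + t) ^ 2 * ‖H ι‖
          | Sum.inr (Sum.inl α) =>
              (1 + t) ^ 2 * (𝔥 * (R ^ (∑ i, (α : Fin d → ℕ) i))⁻¹ * ‖H ι‖)
          | Sum.inr (Sum.inr _) => (1 + t) ^ 2 * ((𝔥 / R) ^ 2 * ‖H ι‖)) := by
      rintro (u | α | q)
      · -- constant monomial: `‖1 • H‖ = ‖H‖ ≤ (1+t)² ‖H‖`
        simp only [relMonomial_const, one_smul]
        rw [tayNorm_const]
        exact le_mul_of_one_le_left (norm_nonneg _) (one_le_pow₀ h1t)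
      · rw [hterm]
        refine (tayNorm_mul_const_le T (hmonoCD _) _ φ).trans ?_
        simp only [relMonomial_lin]
        have hb := tayNorm_linMonomial_le (𝕜 := 𝕜) h𝔥 hR hp hxS α r₀ φ
        have hc : 0 ≤ 𝔥 * (R ^ (∑ i, (α : Fin d → ℕ) i))⁻¹ := by positivity
        calc tayNorm T r₀ (fun ψ : (Fin d → ZMod M) → ℝ =>
              (algebraMap ℝ 𝕜) (iterDiff (α : Fin d → ℕ) ψ x)) φ * ‖H (Sum.inr (Sum.inl α))‖
            ≤ 𝔥 * (R ^ (∑ i, (α : Fin d → ℕ) i))⁻¹ * (t + 1) * ‖H (Sum.inr (Sum.inl α))‖ :=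
              mul_le_mul_of_nonneg_right hb (norm_nonneg _)
          _ ≤ (1 + t) ^ 2 * (𝔥 * (R ^ (∑ i, (α : Fin d → ℕ) i))⁻¹ * ‖H (Sum.inr (Sum.inl α))‖) := by
              have : (t + 1) ≤ (1 + t) ^ 2 := by rw [add_comm]; nlinarith
              have hn : 0 ≤ ‖H (Sum.inr (Sum.inl α))‖ := norm_nonneg _
              nlinarith [mul_nonneg hc hn]
      · rw [hterm]
        refine (tayNorm_mul_const_le T (hmonoCD _) _ φ).trans ?_
        simp only [relMonomial_quad, map_mul]
        have hb1 := tayNorm_gradMonomial_le (𝕜 := 𝕜) h𝔥 hR hp1 hxS q.1.1 r₀ φ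
        have hb2 := tayNorm_gradMonomial_le (𝕜 := 𝕜) h𝔥 hR hp1 hxS q.1.2 r₀ φ
        have hprod := tayNorm_mul_le T (hgradCD q.1.1 x) (hgradCD q.1.2 x) φ
        have hc : 0 ≤ 𝔥 / R := div_nonneg h𝔥.le hR.le
        have hn : 0 ≤ ‖H (Sum.inr (Sum.inr q))‖ := norm_nonneg _
        have hA : 0 ≤ tayNorm T r₀ (fun ψ : (Fin d → ZMod M) → ℝ =>
            (algebraMap ℝ 𝕜) (fwdDiff q.1.1 ψ x)) φ := tayNorm_nonneg _ _ _ _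
        have hB : 0 ≤ tayNorm T r₀ (fun ψ : (Fin d → ZMod M) → ℝ =>
            (algebraMap ℝ 𝕜) (fwdDiff q.1.2 ψ x)) φ := tayNorm_nonneg _ _ _ _
        calc tayNorm T r₀ ((fun ψ : (Fin d → ZMod M) → ℝ => (algebraMap ℝ 𝕜) (fwdDiff q.1.1 ψ x)) *
                fun ψ => (algebraMap ℝ 𝕜) (fwdDiff q.1.2 ψ x)) φ * ‖H (Sum.inr (Sum.inr q))‖
            ≤ (𝔥 / R * (t + 1)) * (𝔥 / R * (t + 1)) * ‖H (Sum.inr (Sum.inr q))‖ := by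
              refine mul_le_mul_of_nonneg_right (hprod.trans (mul_le_mul hb1 hb2 hB ?_)) hn
              exact hA.trans hb1
          _ = (1 + t) ^ 2 * ((𝔥 / R) ^ 2 * ‖H (Sum.inr (Sum.inr q))‖) := by ring
    -- sum over the index set
    calc tayNorm T r₀ (fun ψ : (Fin d → ZMod M) → ℝ => density H ψ x) φ
        = tayNorm T r₀ (fun ψ => ∑ ι : RelIndex d, relMonomial ι ψ x • H ι) φ := rfl
      _ ≤ ∑ ι : RelIndex d, tayNorm T r₀ (fun ψ => relMonomial ι ψ x • H ι) φ :=
          tayNorm_sum_le T Finset.univ (fun ι _ => htermCD ι) φ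
      _ ≤ ∑ ι : RelIndex d, (match ι with
          | Sum.inl _ => (1 + t) ^ 2 * ‖H ι‖
          | Sum.inr (Sum.inl α) =>
              (1 + t) ^ 2 * (𝔥 * (R ^ (∑ i, (α : Fin d → ℕ) i))⁻¹ * ‖H ι‖)
          | Sum.inr (Sum.inr _) => (1 + t) ^ 2 * ((𝔥 / R) ^ 2 * ‖H ι‖)) :=
          Finset.sum_le_sum fun ι _ => hmono ι
      _ = (1 + t) ^ 2 * (‖H (Sum.inl ())‖ +
          ∑ α : linIndex d, 𝔥 * (R ^ (∑ i, (α : Fin d → ℕ) i))⁻¹ * ‖H (Sum.inr (Sum.inl α))‖ +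
          ∑ q : quadIndex d, (𝔥 / R) ^ 2 * ‖H (Sum.inr (Sum.inr q))‖) := by
          simp only [Fintype.sum_sum_type, Fintype.sum_unique, Finset.mul_sum, mul_add,
            PUnit.default_eq_unit]
          rw [add_assoc]
  -- sum over the sites of `B`
  have hdensCD : ∀ x ∈ B, ContDiff ℝ r₀ (fun ψ : (Fin d → ZMod M) → ℝ => density H ψ x) := by
    intro x _
    refine ContDiff.sum fun ι _ => ?_
    have : (fun ψ : (Fin d → ZMod M) → ℝ => relMonomial ι ψ x • H ι) =
        fun ψ => (algebraMap ℝ 𝕜) (relMonomial ι ψ x) * H ι := by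
      funext ψ; exact Algebra.smul_def _ _
    rw [this]
    refine ContDiff.mul ?_ contDiff_const
    rcases ι with (u | α | q)
    · simp only [relMonomial_const, map_one]; exact contDiff_const
    · simp only [relMonomial_lin]; exact hlinCD _ x
    · simp only [relMonomial_quad, map_mul]; exact (hgradCD _ x).mul (hgradCD _ x)
  calc tayNorm T r₀ (fun ψ : (Fin d → ZMod M) → ℝ => eval H B ψ) φ
      = tayNorm T r₀ (fun ψ => ∑ x ∈ B, density H ψ x) φ := rfl
    _ ≤ ∑ x ∈ B, tayNorm T r₀ (fun ψ : (Fin d → ZMod M) → ℝ => density H ψ x) φ :=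
        tayNorm_sum_le T B hdensCD φ
    _ ≤ ∑ x ∈ B, (1 + t) ^ 2 * (‖H (Sum.inl ())‖ +
        ∑ α : linIndex d, 𝔥 * (R ^ (∑ i, (α : Fin d → ℕ) i))⁻¹ * ‖H (Sum.inr (Sum.inl α))‖ +
        ∑ q : quadIndex d, (𝔥 / R) ^ 2 * ‖H (Sum.inr (Sum.inr q))‖) :=
        Finset.sum_le_sum hsite
    _ = (1 + t) ^ 2 * hamNorm 𝔥 R B.card H := by
        rw [Finset.sum_const, nsmul_eq_mul, hamNorm]
        ring

end Hamiltonian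

end Literature.MathematicalPhysics.StatisticalMechanics.GradientRG

end
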